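import Literature.MathematicalPhysics.KineticTheory.HardSphereBBGKYLiouvilleFlow
import Literature.MathematicalPhysics.KineticTheory.HardSphereEuler
import Literature.Analysis.FluidPDE.HardSpherePhaseSpaceProofs
import Mathlib.MeasureTheory.Covering.BesicovitchVectorSpace
import HarnessLib

/-!
# `CollisionActivityTails` (stmt-AtomisticToContinuum-13734), line `SketchK1`: endpoint kinematics

Helper file (`--supports stmt-AtomisticToContinuum-13734`) for the crux
`Summit.AtomisticToContinuum.HydrodynamicLimit.Theses.OneFlightGossipEngine.CollisionActivityTails`
(shared with `…Theses.TwoClocks.CollisionActivityTails`), skeleton line `SketchK1`, registered stub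
`stub_endpointKinematics`.

The line dominates the window collisional activity `a_i` of a tagged sphere by three functionals,
`a_i ≤ F¹_i + C (F²_i + Fcr_i)`; this file prices the ENDPOINT TERM
`F¹_i = (σ/τ) [P_i(s) + P_i(s + w)]`, `P_i(y) = Σ_{j ≠ i, dist(x_j, x_i) ≤ 2ε} |v_j − v_i|`
(near-field relative momentum at the two endpoint times of the window), deterministically on the
good set of the flow:

  `Σ_i (F¹_i)² ≤ K (σ/τ)² E(z)`, `E = configEnergy` (`stub_endpointKinematics`, `K = 500000`).

Proof.
* HARD-CORE PACKING (`card_near_le`): in a configuration of the hard-sphere domain of diameter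
  `ε > 0` on `𝕋³`, at most `125 = 5³` centres lie within minimal-image distance `2ε` of a given
  centre `x_i`. Lift the near centres to `w_j = reprSym (x_j − x_i) ∈ ℝ³`, `‖w_j‖ ≤ 2ε`; distinct
  near centres have `‖w_j − w_{j'}‖ ≥ dist_{𝕋³}(x_j, x_{j'}) ≥ ε`
  (`Torus.euclidDist_proj_le_norm_sub_holds`, `Torus.proj_reprSym`), so `{ε⁻¹ w_j}` is a
  `1`-separated set in the ball of radius `2` and `Besicovitch.card_le_of_separated` applies.
* CAUCHY–SCHWARZ (`relMomentumNear_sq_le`): `P_i² ≤ 125 Σ_{j near i, j ≠ i} |v_j − v_i|²`, and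
  `|v_j − v_i|² ≤ 2|v_j|² + 2|v_i|²`.
* DOUBLE COUNTING (`sum_nearEnergy_le`): each `j` is near at most `125` centres (nearness is
  symmetric, `Torus.euclidDist_comm`), so `Σ_i Σ_{j near i} |v_j|² ≤ 125 Σ_j |v_j|²`; altogether
  `Σ_i P_i(y)² ≤ 125000 E(y)` (`sum_relMomentumNear_sq_le`).
* ENERGY CONSERVATION on the good set (`HardSphereFlow.configEnergy_flow`):
  `E(Φ_s z) = E(Φ_{s+w} z) = E(z)`, and `(a + b)² ≤ 2 (a² + b²)`.

References: I. Gallagher, L. Saint-Raymond, B. Texier, *From Newton to Boltzmann* (2013), §1.1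
(energy conservation), Ch. 4 intro (minimal images on the periodic box).
-/

noncomputable section

open MeasureTheory Set
open scoped ENNReal

namespace Summit.AtomisticToContinuum.HydrodynamicLimit.Theorems.CollisionActivityTailsEndpointKinematics

open Literature.MathematicalPhysics.KineticTheory Literature.Analysis.FluidPDE

/-! ## Vocabulary of the line (verbatim from the skeleton `SketchK1`) -/

/-- A hard-sphere flow of `N + 1` spheres of reduced diameter `σ` on `𝕋³` (the crux's `Φ N`). -/
abbrev Flow (σ : ℝ) (N : ℕ) : Type :=
  HardSphereFlow (Torus.geometry (Fin 3)) (hsDiameter σ N) (N + 1)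

/-- Phase space of `N + 1` spheres on `𝕋³`. -/
abbrev Cfg (N : ℕ) : Type := Config (N + 1) (Fin 3) T3

/-- The crux's window `w_N = τ (N+1)^{-1/3}`. -/
def window (τ : ℝ) (N : ℕ) : ℝ := τ * ((N : ℝ) + 1) ^ (-(1 / 3 : ℝ))

/-- Minimal-image distance of two points of `𝕋³` (norm of the torus geometry's separation vector). -/
def tdist (x y : T3) : ℝ := ‖(Torus.geometry (Fin 3)).sepVec x y‖

/-- Near-field relative momentum at `i`: `Σ_{j ≠ i, dist(x_j, x_i) ≤ r} |v_j − v_i|`. -/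
def relMomentumNear {N : ℕ} (z : Cfg N) (i : Fin (N + 1)) (r : ℝ) : ℝ :=
  ∑ j : Fin (N + 1), if j ≠ i ∧ tdist (z j).1 (z i).1 ≤ r then ‖(z j).2 - (z i).2‖ else 0

/-- `F¹_i`: ENDPOINT TERM — `(σ/τ) ×` the near-field (radius `2ε`) relative momentum at `i` at the two endpoint times
of the window (the boundary values `|G_i(s)|, |G_i(s+w)| ≤ 2ε P_i` of the co-moving virial, in activity units). -/
def endpointTerm {σ : ℝ} {N : ℕ} (Φ : Flow σ N) (τ s : ℝ) (i : Fin (N + 1)) (z : Cfg N) : ℝ :=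
  σ / τ * (relMomentumNear (Φ.flow s z) i (2 * hsDiameter σ N) +
    relMomentumNear (Φ.flow (s + window τ N) z) i (2 * hsDiameter σ N))

/-- **ENDPOINT KINEMATICS** (deterministic; stub 2). There is an absolute constant `K` such that for
`0 < σ ≤ 1/8`, every `N`, flow, `τ > 0`, `s` and every good datum `z`:
`Σ_i (F¹_i)² ≤ K (σ/τ)² E(z)`, `E = configEnergy` (hard-core packing: at most `K₀` centres within `2ε` of a centre;
Cauchy–Schwarz `P_i² ≤ K₀ Σ_{near} |v_j − v_i|² ≤ 2K₀ (Σ_{near}|v_j|² + K₀|v_i|²)`; each `j` is near at most `K₀`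
centres; energy conservation `E(Φ_t z) = E(z)` on the good set). -/
def EndpointKinematics : Prop :=
  ∃ K : ℝ, 0 < K ∧ ∀ (σ : ℝ), 0 < σ → σ ≤ 1 / 8 → ∀ (N : ℕ) (Φ : Flow σ N) (τ : ℝ), 0 < τ →
    ∀ (s : ℝ), ∀ z ∈ Φ.good,
      ∑ i : Fin (N + 1), (endpointTerm Φ τ s i z) ^ 2 ≤ K * (σ / τ) ^ 2 * configEnergy z

/-! ## Hard-core packing on `𝕋³` -/

variable {N : ℕ}

/-- `tdist` is symmetric. -/
theorem tdist_comm (x y : T3) : tdist x y = tdist y x := Torus.euclidDist_comm x y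

/-- The lifted separation vector `w_j = reprSym (x_j − x_i) ∈ ℝ³` of centre `j` relative to centre `i`. -/
def lift (y : Cfg N) (i j : Fin (N + 1)) : V3 := Torus.reprSym ((y j).1 - (y i).1)

/-- The lift has norm the minimal-image distance of the two centres. -/
theorem norm_lift (y : Cfg N) (i j : Fin (N + 1)) : ‖lift y i j‖ = tdist (y j).1 (y i).1 := rfl

/-- Two lifts (relative to the same centre) are at least as far apart in `ℝ³` as the two centres are
on the torus: `dist_{𝕋³}(x_j, x_{j'}) = dist_{𝕋³}(proj w_j, proj w_{j'}) ≤ ‖w_j − w_{j'}‖`. -/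
theorem tdist_le_norm_lift_sub (y : Cfg N) (i j j' : Fin (N + 1)) :
    tdist (y j).1 (y j').1 ≤ ‖lift y i j - lift y i j'‖ := by
  have h := Torus.euclidDist_proj_le_norm_sub_holds (lift y i j) (lift y i j')
  have hj : Literature.Analysis.FunctionSpaces.Torus.proj (lift y i j) = (y j).1 - (y i).1 :=
    Torus.proj_reprSym _
  have hj' : Literature.Analysis.FunctionSpaces.Torus.proj (lift y i j') = (y j').1 - (y i).1 :=
    Torus.proj_reprSym _
  rw [hj, hj', Torus.euclidDist_eq, sub_sub_sub_cancel_right] at h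
  exact h

/-- **Hard-core packing.** In a configuration of the hard-sphere domain (pairwise minimal-image
distances `≥ ε > 0`), at most `125 = 5³` centres lie within `2ε` of any given centre: the rescaled
lifts `ε⁻¹ w_j ∈ ℝ³` form a `1`-separated set in the ball of radius `2`
(`Besicovitch.card_le_of_separated`). -/
theorem card_near_le {ε : ℝ} (hε : 0 < ε) {y : Cfg N}
    (hy : y ∈ hardSphereDomain (Torus.geometry (Fin 3)) (N + 1) ε) (i : Fin (N + 1)) :
    (Finset.univ.filter fun j : Fin (N + 1) => tdist (y j).1 (y i).1 ≤ 2 * ε).card ≤ 125 := by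
  classical
  set S := Finset.univ.filter fun j : Fin (N + 1) => tdist (y j).1 (y i).1 ≤ 2 * ε with hS
  set f : Fin (N + 1) → V3 := fun j => ε⁻¹ • lift y i j with hf
  have hsep : ∀ j j', j ≠ j' → 1 ≤ ‖f j - f j'‖ := by
    intro j j' hjj'
    have h1 : ε ≤ tdist (y j).1 (y j').1 := hy j j' hjj'
    have h2 := tdist_le_norm_lift_sub y i j j'
    rw [hf, ← smul_sub, norm_smul, norm_inv, Real.norm_eq_abs, abs_of_pos hε,
      ← div_eq_inv_mul, le_div_iff₀ hε, one_mul]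
    exact h1.trans h2
  have hinj : Set.InjOn f S := by
    intro j _ j' _ hjj'
    by_contra hne
    have h := hsep j j' hne
    rw [hjj', sub_self, norm_zero] at h
    exact absurd h (by norm_num)
  have hnorm : ∀ c ∈ S.image f, ‖c‖ ≤ 2 := by
    intro c hc
    obtain ⟨j, hj, rfl⟩ := Finset.mem_image.1 hc
    have hj' : tdist (y j).1 (y i).1 ≤ 2 * ε := (Finset.mem_filter.1 hj).2
    rw [hf, norm_smul, norm_inv, Real.norm_eq_abs, abs_of_pos hε, norm_lift,
      inv_mul_le_iff₀ hε]
    linarith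
  have hsep' : ∀ c ∈ S.image f, ∀ d ∈ S.image f, c ≠ d → 1 ≤ ‖c - d‖ := by
    intro c hc d hd hcd
    obtain ⟨j, -, rfl⟩ := Finset.mem_image.1 hc
    obtain ⟨j', -, rfl⟩ := Finset.mem_image.1 hd
    exact hsep j j' fun h => hcd (by rw [h])
  calc S.card = (S.image f).card := (Finset.card_image_of_injOn hinj).symm
    _ ≤ 5 ^ Module.finrank ℝ V3 := Besicovitch.card_le_of_separated _ hnorm hsep'
    _ = 125 := by rw [finrank_euclideanSpace_fin]; norm_num

/-! ## Cauchy–Schwarz and double counting -/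

/-- Near-field kinetic energy seen from `i`: `Σ_{j : dist(x_j, x_i) ≤ 2ε} |v_j|²` (including `j = i`). -/
def nearEnergy (y : Cfg N) (ε : ℝ) (i : Fin (N + 1)) : ℝ :=
  ∑ j : Fin (N + 1), if tdist (y j).1 (y i).1 ≤ 2 * ε then ‖(y j).2‖ ^ 2 else 0

/-- `|a − b|² ≤ 2|a|² + 2|b|²`. -/
theorem norm_sub_sq_le (a b : V3) : ‖a - b‖ ^ 2 ≤ 2 * ‖a‖ ^ 2 + 2 * ‖b‖ ^ 2 := by
  have h : ‖a - b‖ ^ 2 ≤ (‖a‖ + ‖b‖) ^ 2 := pow_le_pow_left₀ (norm_nonneg _) (norm_sub_le a b) 2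
  nlinarith [sq_nonneg (‖a‖ - ‖b‖)]

/-- A sum of a constant over the near centres is the near count times the constant. -/
theorem sum_ite_near_const (y : Cfg N) (ε : ℝ) (i : Fin (N + 1)) (c : ℝ) :
    (∑ j : Fin (N + 1), if tdist (y j).1 (y i).1 ≤ 2 * ε then c else 0) =
      (Finset.univ.filter fun j : Fin (N + 1) => tdist (y j).1 (y i).1 ≤ 2 * ε).card * c := by
  rw [← Finset.sum_filter, Finset.sum_const, nsmul_eq_mul]

/-- **Cauchy–Schwarz.** `P_i² ≤ 125 · Σ_{j ≠ i near i} |v_j − v_i|² ≤ 250 · nearEnergy_i + 31250 |v_i|²`. -/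
theorem relMomentumNear_sq_le {ε : ℝ} (hε : 0 < ε) {y : Cfg N}
    (hy : y ∈ hardSphereDomain (Torus.geometry (Fin 3)) (N + 1) ε) (i : Fin (N + 1)) :
    relMomentumNear y i (2 * ε) ^ 2 ≤ 250 * nearEnergy y ε i + 31250 * ‖(y i).2‖ ^ 2 := by
  set S' := Finset.univ.filter fun j : Fin (N + 1) => j ≠ i ∧ tdist (y j).1 (y i).1 ≤ 2 * ε
    with hS'
  have hcount := card_near_le hε hy i
  have hcard : S'.card ≤ 125 := by
    refine le_trans (Finset.card_le_card fun j hj => ?_) hcount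
    simp only [hS', Finset.mem_filter, Finset.mem_univ, true_and] at hj ⊢
    exact hj.2
  have hcardR : (S'.card : ℝ) ≤ 125 := by exact_mod_cast hcard
  have hcountR : ((Finset.univ.filter fun j : Fin (N + 1) => tdist (y j).1 (y i).1 ≤ 2 * ε).card : ℝ)
      ≤ 125 := by exact_mod_cast hcount
  have hP : relMomentumNear y i (2 * ε) = ∑ j ∈ S', ‖(y j).2 - (y i).2‖ := by
    rw [relMomentumNear, hS', Finset.sum_filter]
  -- Cauchy–Schwarz over the filtered finset
  have hCS : relMomentumNear y i (2 * ε) ^ 2 ≤ 125 * ∑ j ∈ S', ‖(y j).2 - (y i).2‖ ^ 2 := by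
    rw [hP]
    calc (∑ j ∈ S', ‖(y j).2 - (y i).2‖) ^ 2 ≤ S'.card * ∑ j ∈ S', ‖(y j).2 - (y i).2‖ ^ 2 :=
          sq_sum_le_card_mul_sum_sq
      _ ≤ 125 * ∑ j ∈ S', ‖(y j).2 - (y i).2‖ ^ 2 :=
          mul_le_mul_of_nonneg_right hcardR (Finset.sum_nonneg fun j _ => sq_nonneg _)
  -- back to indicator sums and the pointwise bound `|v_j − v_i|² ≤ 2|v_j|² + 2|v_i|²`
  have hsum : ∑ j ∈ S', ‖(y j).2 - (y i).2‖ ^ 2 ≤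
      2 * nearEnergy y ε i + 2 * (125 * ‖(y i).2‖ ^ 2) := by
    rw [hS', Finset.sum_filter]
    calc (∑ j, if j ≠ i ∧ tdist (y j).1 (y i).1 ≤ 2 * ε then ‖(y j).2 - (y i).2‖ ^ 2 else 0)
        ≤ ∑ j, (2 * (if tdist (y j).1 (y i).1 ≤ 2 * ε then ‖(y j).2‖ ^ 2 else 0) +
            2 * (if tdist (y j).1 (y i).1 ≤ 2 * ε then ‖(y i).2‖ ^ 2 else 0)) := by
          refine Finset.sum_le_sum fun j _ => ?_
          by_cases hn : tdist (y j).1 (y i).1 ≤ 2 * ε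
          · by_cases hji : j ≠ i
            · rw [if_pos ⟨hji, hn⟩, if_pos hn, if_pos hn]
              linarith [norm_sub_sq_le (y j).2 (y i).2]
            · rw [if_neg (fun h => hji h.1), if_pos hn, if_pos hn]
              positivity
          · rw [if_neg (fun h => hn h.2), if_neg hn, if_neg hn]
            simp
      _ = 2 * nearEnergy y ε i +
            2 * ∑ j, (if tdist (y j).1 (y i).1 ≤ 2 * ε then ‖(y i).2‖ ^ 2 else 0) := by
          rw [Finset.sum_add_distrib, ← Finset.mul_sum, ← Finset.mul_sum, nearEnergy]
      _ ≤ 2 * nearEnergy y ε i + 2 * (125 * ‖(y i).2‖ ^ 2) := by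
          rw [sum_ite_near_const]
          have h0 : 0 ≤ ‖(y i).2‖ ^ 2 := sq_nonneg _
          nlinarith
  linarith

/-- **Double counting.** Each centre is near (within `2ε` of) at most `125` centres, so
`Σ_i nearEnergy_i ≤ 125 Σ_j |v_j|²`. -/
theorem sum_nearEnergy_le {ε : ℝ} (hε : 0 < ε) {y : Cfg N}
    (hy : y ∈ hardSphereDomain (Torus.geometry (Fin 3)) (N + 1) ε) :
    ∑ i, nearEnergy y ε i ≤ 125 * ∑ j, ‖(y j).2‖ ^ 2 := by
  unfold nearEnergy
  rw [Finset.sum_comm, Finset.mul_sum]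
  refine Finset.sum_le_sum fun j _ => ?_
  have hsymm : (∑ i, if tdist (y j).1 (y i).1 ≤ 2 * ε then ‖(y j).2‖ ^ 2 else (0 : ℝ)) =
      ∑ i, if tdist (y i).1 (y j).1 ≤ 2 * ε then ‖(y j).2‖ ^ 2 else (0 : ℝ) := by
    refine Finset.sum_congr rfl fun i _ => ?_
    rw [tdist_comm]
  rw [hsymm, sum_ite_near_const]
  have hc : ((Finset.univ.filter fun i : Fin (N + 1) => tdist (y i).1 (y j).1 ≤ 2 * ε).card : ℝ)
      ≤ 125 := by exact_mod_cast card_near_le hε hy j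
  exact mul_le_mul_of_nonneg_right hc (sq_nonneg _)

/-- **Near-field relative momenta are controlled by the energy**: `Σ_i P_i(y)² ≤ 125000 E(y)` in
the hard-sphere domain of diameter `ε > 0` (near-field radius `2ε`). -/
theorem sum_relMomentumNear_sq_le {ε : ℝ} (hε : 0 < ε) {y : Cfg N}
    (hy : y ∈ hardSphereDomain (Torus.geometry (Fin 3)) (N + 1) ε) :
    ∑ i, relMomentumNear y i (2 * ε) ^ 2 ≤ 125000 * configEnergy y := by
  have hE : ∑ j, ‖(y j).2‖ ^ 2 = 2 * configEnergy y := by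
    rw [configEnergy, ← mul_assoc, mul_inv_cancel₀ (two_ne_zero), one_mul]
  calc ∑ i, relMomentumNear y i (2 * ε) ^ 2
      ≤ ∑ i, (250 * nearEnergy y ε i + 31250 * ‖(y i).2‖ ^ 2) :=
        Finset.sum_le_sum fun i _ => relMomentumNear_sq_le hε hy i
    _ = 250 * ∑ i, nearEnergy y ε i + 31250 * ∑ i, ‖(y i).2‖ ^ 2 := by
        rw [Finset.sum_add_distrib, ← Finset.mul_sum, ← Finset.mul_sum]
    _ ≤ 250 * (125 * ∑ j, ‖(y j).2‖ ^ 2) + 31250 * ∑ i, ‖(y i).2‖ ^ 2 := by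
        have h := sum_nearEnergy_le hε hy
        linarith
    _ = 125000 * configEnergy y := by rw [hE]; ring

/-! ## The stub -/

/-- **STUB 2 of line `SketchK1` (endpoint kinematics).** `Σ_i (F¹_i)² ≤ 500000 (σ/τ)² E(z)` on the
good set: the two orbit points `Φ_s z`, `Φ_{s+w} z` lie in the hard-sphere domain
(`good_subset`, `mapsTo_good`), `Σ_i P_i² ≤ 125000 E` there (`sum_relMomentumNear_sq_le`), the
energy is conserved (`HardSphereFlow.configEnergy_flow`), and `(a + b)² ≤ 2(a² + b²)`. -/
theorem stub_endpointKinematics : EndpointKinematics := by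
  refine ⟨500000, by norm_num, ?_⟩
  intro σ hσ _hσ N Φ τ _hτ s z hz
  have hε : 0 < hsDiameter σ N := hsDiameter_pos hσ N
  have h1 : Φ.flow s z ∈ hardSphereDomain (Torus.geometry (Fin 3)) (N + 1) (hsDiameter σ N) :=
    Φ.good_subset (Φ.mapsTo_good s hz)
  have h2 : Φ.flow (s + window τ N) z ∈
      hardSphereDomain (Torus.geometry (Fin 3)) (N + 1) (hsDiameter σ N) :=
    Φ.good_subset (Φ.mapsTo_good _ hz)
  have hA := sum_relMomentumNear_sq_le hε h1
  have hB := sum_relMomentumNear_sq_le hε h2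
  rw [Φ.configEnergy_flow hz] at hA hB
  calc ∑ i, endpointTerm Φ τ s i z ^ 2
      ≤ ∑ i, (σ / τ) ^ 2 * (2 * (relMomentumNear (Φ.flow s z) i (2 * hsDiameter σ N) ^ 2 +
          relMomentumNear (Φ.flow (s + window τ N) z) i (2 * hsDiameter σ N) ^ 2)) := by
        refine Finset.sum_le_sum fun i _ => ?_
        rw [endpointTerm, mul_pow]
        refine mul_le_mul_of_nonneg_left ?_ (sq_nonneg _)
        nlinarith [sq_nonneg (relMomentumNear (Φ.flow s z) i (2 * hsDiameter σ N) -
          relMomentumNear (Φ.flow (s + window τ N) z) i (2 * hsDiameter σ N))]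
    _ = (σ / τ) ^ 2 * (2 * (∑ i, relMomentumNear (Φ.flow s z) i (2 * hsDiameter σ N) ^ 2 +
          ∑ i, relMomentumNear (Φ.flow (s + window τ N) z) i (2 * hsDiameter σ N) ^ 2)) := by
        rw [← Finset.sum_add_distrib, Finset.mul_sum, Finset.mul_sum]
    _ ≤ (σ / τ) ^ 2 * (2 * (125000 * configEnergy z + 125000 * configEnergy z)) := by
        gcongr
    _ = 500000 * (σ / τ) ^ 2 * configEnergy z := by ring

end Summit.AtomisticToContinuum.HydrodynamicLimit.Theorems.CollisionActivityTailsEndpointKinematics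

end
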